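/-
Origin: expansion seat `planner-pub-hodgecm-toy-g2-0`, handover #19 2026-08-18T08:23:05Z (`HOME/pub-hodgecm-toy-g2/lean/ToyG2/GysinPlan.lean`, md5 f5344f9b, 128 lines);
landed by the gen-7 packager in gate run 26 as `HodgeCM/Model/ToyG2/GysinPlan.lean` (import ^import ToyG2\.→import HodgeCM.Model.ToyG2. ×1).
-/
/-
# HodgeCM.Model.ToyG2.GysinPlan — the typed reduction of M26 on the repaired universe (DESIGN.md §9, G0)

Generation 2 of the `pub-hodgecm-toy` lineage (seat `planner-pub-hodgecm-toy-g2-0`).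

M26 `Fact_gysin_surface` is the one field of `ModelAxioms` not yet proved for
`toyModel3With exteriorHodgeData traceSys pl` (`Universe3.toyModel3_axioms_of`).  This file TYPES its reduction
to two statements of finite-dimensional linear algebra over the generation-2 objects and proves the assembly:

* `trPairing X i j` / `leftRad X i j` : the trace pairing `(y, c) ↦ tr_X (y ∧ c)` on `⋀^i ⊗ ⋀^j` and its left radical;
* `TrType X`      : the trace of `X` has Hodge type `(dim X, dim X)`;
* `RadKilled S X f` : the pulled-back surface trace `λ_f = tr_S ∘ ⋀⁴ f^*` kills the left radical of `X` (G1);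
* `HodgeRiesz X`  : every rational functional on `⋀⁴ H¹(X)` of type (2,2) killing the left radical is
                    `y ↦ tr_X (y ∧ c)` for a Hodge class `c` (G2a + G3);
* `pull_type22_of_trType` : G2c — `λ_f` has type (2,2) as soon as `TrType S` and `dim S = 2`
  (from `Good.baseC_comp_map` and `HodgeWeight.wt_comp_map`);
* `trType_pbObj` : `TrType` for a good block;
* **`gysin_of`** : `(∀ good S of dim 2, TrType S) → (∀ good S X f, RadKilled S X f) → (∀ good X, HodgeRiesz X)
  → Fact_gysin_surface`, and its specialisation `toyUniverse₃_modelAxioms_of`.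

Nothing here is deep; the point is that the remaining generation-3 work now has kernel-checked signatures
with the degree arithmetic (`4 + 2 (dim X − 2)`) fixed once.
-/
import Mathlib
import Summits.HodgeConjecture.HodgeCM.Model.ToyG2.Universe3

namespace HodgeCM.ToyG2

open HodgeCM.Toy HodgeCM.Toy.CMPresentation
open Literature.AlgebraicGeometry.Motives
open scoped TensorProduct
open exteriorPower Obj₂

noncomputable section

/-! ### The trace pairing and its left radical -/

/-- `(y, c) ↦ tr_X (y ∧ c)` on `⋀^i H¹(X) × ⋀^j H¹(X)` -/
def trPairing (X : Obj₂) (i j : ℕ) : (⋀[ℚ]^i X.L) →ₗ[ℚ] (⋀[ℚ]^j X.L) →ₗ[ℚ] ℚ :=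
  (wedge ℚ X.L i j).compr₂ (trOf X (i + j))

/-- (Ported verbatim from the HodgeCMPerL package; no docstring in the source.) -/
@[simp] lemma trPairing_apply (X : Obj₂) (i j : ℕ) (y : ⋀[ℚ]^i X.L) (c : ⋀[ℚ]^j X.L) :
    trPairing X i j y c = trOf X (i + j) (wedge ℚ X.L i j y c) := rfl

/-- the left radical `{y | ∀ c, tr_X (y ∧ c) = 0}` -/
def leftRad (X : Obj₂) (i j : ℕ) : Submodule ℚ (⋀[ℚ]^i X.L) := LinearMap.ker (trPairing X i j)

/-- (Ported verbatim from the HodgeCMPerL package; no docstring in the source.) -/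
lemma mem_leftRad {X : Obj₂} {i j : ℕ} {y : ⋀[ℚ]^i X.L} :
    y ∈ leftRad X i j ↔ ∀ c, trOf X (i + j) (wedge ℚ X.L i j y c) = 0 := by
  simp only [leftRad, LinearMap.mem_ker, LinearMap.ext_iff, trPairing_apply, LinearMap.zero_apply]

/-! ### The three statements -/

/-- the trace of `X` has Hodge type `(dim X, dim X)`: `(tr_X)_ℂ ∘ wt z = z^{dim X} • (tr_X)_ℂ` in every degree
(trivial off degree `2 dim X`, where `tr_X = 0`) -/
def TrType (X : Obj₂) : Prop :=
  ∀ (n : ℕ) (z : ℂ), baseC X.toObj (trOf X n) ∘ₗ X.toObj.wt z n = (z ^ X.dim) • baseC X.toObj (trOf X n)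

/-- G1: the pulled-back surface trace kills the left radical of the trace pairing of `X` -/
def RadKilled (S X : Obj₂) (f : Hom₂ S X) : Prop :=
  ∀ y ∈ leftRad X 4 (2 * (X.dim - 2)), trOf S 4 (map 4 f.lin y) = 0

/-- G2a + G3 (Hodge–Riesz): a rational functional on `⋀⁴ H¹(X)` of type (2,2) killing the left radical is
`tr_X (· ∧ c)` for a Hodge class `c` of degree `2 (dim X − 2)` -/
def HodgeRiesz (X : Obj₂) : Prop :=
  ∀ lam : (⋀[ℚ]^4 X.L) →ₗ[ℚ] ℚ,
    (∀ z : ℂ, baseC X.toObj lam ∘ₗ X.toObj.wt z 4 = (z ^ 2) • baseC X.toObj lam) →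
    (∀ y ∈ leftRad X 4 (2 * (X.dim - 2)), lam y = 0) →
    ∃ c ∈ (exteriorHodgeData.hs X.toObj (2 * (X.dim - 2))).hodgeClasses ((X.dim - 2 : ℕ) : ℤ),
      ∀ y, lam y = trOf X (4 + 2 * (X.dim - 2)) (wedge ℚ X.L 4 (2 * (X.dim - 2)) y c)

/-! ### G2c: the pulled-back trace has type (2,2) -/

section

variable {S X : Obj₂}

/-- `λ_f = tr_S ∘ ⋀⁴ f^*` has type (2,2) whenever `tr_S` has type `(2,2)` -/
theorem pull_type22_of_trType (f : Hom₂ S X) (hS : S.dim = 2) (hT : TrType S) (z : ℂ) :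
    baseC X.toObj (trOf S 4 ∘ₗ map 4 f.lin) ∘ₗ X.toObj.wt z 4
      = (z ^ 2) • baseC X.toObj (trOf S 4 ∘ₗ map 4 f.lin) := by
  have h := hT 4 z
  rw [hS] at h
  change baseC X.toObj (trOf S 4 ∘ₗ map 4 f.hom.lin) ∘ₗ X.toObj.wt z 4
    = (z ^ 2) • baseC X.toObj (trOf S 4 ∘ₗ map 4 f.hom.lin)
  rw [baseC_comp_map, LinearMap.comp_assoc, ← Obj.wt_comp_map f.hom z 4, ← LinearMap.comp_assoc, h,
    LinearMap.smul_comp]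

end

/-! ### `TrType` for a good block -/

/-- (Ported verbatim from the HodgeCMPerL package; no docstring in the source.) -/
lemma baseC_zero (M : Obj) (k : ℕ) : baseC M (0 : (⋀[ℚ]^k M.L) →ₗ[ℚ] ℚ) = 0 :=
  (baseCHom M k).map_zero

/-- (Ported verbatim from the HodgeCMPerL package; no docstring in the source.) -/
theorem trType_pbObj {p : PLeaf} (h : (Leaf.pb p).Good) : TrType (pbObj p) := by
  intro n z
  by_cases hn : sdeg (pbObj p).s (pbObj p).leaf = n
  · rw [sdeg_pbObj] at hn
    subst hn
    rw [trOf_pbObj, dim_pbObj]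
    exact h.2 z
  · rw [trOf_of_ne hn, baseC_zero, LinearMap.zero_comp, smul_zero]

/-! ### G0: the assembly -/

/-- **M26 from G1 + (G2a–G3) + TrType**, on the repaired universe -/
theorem gysin_of (pl : GBlocks)
    (hT : ∀ S : Obj₂, S.Good → S.dim = 2 → TrType S)
    (h1 : ∀ (S X : Obj₂) (f : Hom₂ S X), S.Good → X.Good → S.dim = 2 → RadKilled S X f)
    (h2 : ∀ X : Obj₂, X.Good → HodgeRiesz X) :
    (toyModel3With exteriorHodgeData traceSys pl).Fact_gysin_surface := by
  intro S X f hS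
  change S.X.dim = 2 at hS
  obtain ⟨c, hc, hyc⟩ := h2 X.X X.good (trOf S.X 4 ∘ₗ map 4 f.lin)
    (pull_type22_of_trType f hS (hT S.X S.good hS)) (fun y hy => h1 S.X X.X f S.good X.good hS y hy)
  exact ⟨c, hc, fun y => hyc y⟩

/-- hence: **`ModelAxioms` for every `toyUniverse₃ d t` from the three linear-algebra statements** -/
theorem toyUniverse₃_modelAxioms_of (d t : ℚ)
    (hT : ∀ S : Obj₂, S.Good → S.dim = 2 → TrType S)
    (h1 : ∀ (S X : Obj₂) (f : Hom₂ S X), S.Good → X.Good → S.dim = 2 → RadKilled S X f)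
    (h2 : ∀ X : Obj₂, X.Good → HodgeRiesz X) : (toyUniverse₃ d t).ModelAxioms :=
  toyUniverse₃_modelAxioms_of_gysin d t (gysin_of (gplOf d t) hT h1 h2)

end

end HodgeCM.ToyG2
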